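import Summits.Ventures.HodgeRepro2.T5AntidiagonalForm
import Summits.Ventures.HodgeRepro2.T5UnipotentCommutator
import Summits.Ventures.HodgeRepro2.T5CongruenceConjugation

/-!
# T5HyperbolicUnitaryElements — `U(1,1)`: the dictionary with p3's `hypUnitary`, the lower unipotent, the
torus, the Weyl element, and the core reduction `n⁻(−c/a) · g · n(−b/a) = diag(a, star(a)⁻¹)`

Blind cell pub-hodge-repro2, seat p8, Tier-5 kernel support (first half of the Cartan decomposition of
`U(1,1)`; the second half — the valuation argument and the assembly — is T5CartanUnitaryRankOne).

p3's T5UnipotentCommutator (p391936) already holds `hypUnitary E = {g ∈ GL₂(E) | gᴴ ℍ g = ℍ}` with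
`ℍ = !![0, 1; 1, 0]`, the upper unipotent `unipUnit x = !![1, x; 0, 1]` (in `U(ℍ)` iff `star x = −x`), the
torus element `diagUnit t = diag(t, star(t)⁻¹)` and `conjTranspose_fin_two`; these are REUSED BY IMPORT.
This file adds:

* `formUnitaryGroup_hyperbolicGram` — the DICTIONARY: p8's `formUnitaryGroup (antidiag(1,1))` IS p3's
  `hypUnitary E` (the same subgroup of `GL₂(E)`), so every statement of T5UnitaryHeckeAdjoint applies to
  `hypUnitary E` and every lemma of T5UnipotentCommutator to `formUnitaryGroup (hyperbolicGram E)`;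
* `mem_iff_fin_two` — membership entrywise: `!![a, b; c, d] ∈ U(1,1)` iff the four isotropy relations
  `star c · a + star a · c = 0`, `star c · b + star a · d = 1`, `star d · a + star b · c = 1`,
  `star d · b + star b · d = 0`;
* the LOWER unipotent `lowerUnip y = !![1, 0; y, 1]` (not in p3's file) with its membership and integrality,
  the integrality of `unipUnit`, `diagUnit`, and the Weyl element `J = P_rev` (`J ∈ U(1,1) ∩ GL₂(R)`, `J` swaps
  rows / columns);
* THE CORE REDUCTION (`lowerUnip_mul`, `lowerUnip_mul_mul_unipUnit`): for `!![a, b; c, d] ∈ U(1,1)` with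
  `a ≠ 0`, `n⁻(−c/a) · g · n(−b/a) = diag(a, star(a)⁻¹)`, the parameters `−c/a`, `−b/a` being PURELY
  IMAGINARY by the isotropy relations (`star_neg_div_of_rel`, `star_neg_div_of_upper`).

Nothing about a valuation yet.
-/

namespace Summit.Ventures.HodgeRepro2.T5HyperbolicUnitaryElements

open Summit.Ventures.HodgeRepro2 Matrix

section Map

variable {R E : Type*} [CommRing R] [CommRing E]

/-- Entrywise image of an explicit `2 × 2` matrix. -/
theorem map_fin_two (f : R →+* E) (p q r s : R) :
    (!![p, q; r, s]).map f = !![f p, f q; f r, f s] := by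
  ext i j
  fin_cases i <;> fin_cases j <;> rfl

omit [CommRing E] in
/-- Equality of explicit `2 × 2` matrices, entrywise. -/
theorem fin_two_eq_iff (p q r s p' q' r' s' : E) :
    !![p, q; r, s] = !![p', q'; r', s'] ↔ p = p' ∧ q = q' ∧ r = r' ∧ s = s' := by
  constructor
  · intro h
    exact ⟨congrFun (congrFun h 0) 0, congrFun (congrFun h 0) 1, congrFun (congrFun h 1) 0,
      congrFun (congrFun h 1) 1⟩
  · rintro ⟨rfl, rfl, rfl, rfl⟩
    rfl

end Map

section MatricesNoStar

variable {E : Type*} [CommRing E]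

/-- The Gram matrix of the hyperbolic plane, `antidiag(1, 1)`. -/
abbrev hyperbolicGram (E : Type*) [CommRing E] : Matrix (Fin 2) (Fin 2) E :=
  T5AntidiagonalForm.antidiagonalMatrix ![1, 1]

/-- `antidiag(1, 1) = !![0, 1; 1, 0]` (= p3's `hyperbolicPlane`). -/
theorem hyperbolicGram_eq : hyperbolicGram E = !![0, 1; 1, 0] := by
  ext i j
  fin_cases i <;> fin_cases j <;> rfl

/-- The lower unipotent `n⁻(y) = !![1, 0; y, 1]` as a unit (p3's `unipUnit` is the upper one). -/
def lowerUnip (y : E) : GL (Fin 2) E where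
  val := !![1, 0; y, 1]
  inv := !![1, 0; -y, 1]
  val_inv := by
    rw [Matrix.mul_fin_two, Matrix.one_fin_two, fin_two_eq_iff]
    exact ⟨by ring, by ring, by ring, by ring⟩
  inv_val := by
    rw [Matrix.mul_fin_two, Matrix.one_fin_two, fin_two_eq_iff]
    exact ⟨by ring, by ring, by ring, by ring⟩

/-- `lowerUnip` on the matrices. -/
theorem coe_lowerUnip (y : E) : (lowerUnip y : Matrix (Fin 2) (Fin 2) E) = !![1, 0; y, 1] := rfl

/-- The inverse of `n⁻(y)` is `n⁻(−y)`. -/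
theorem lowerUnip_inv (y : E) : (lowerUnip y)⁻¹ = lowerUnip (-y) := Units.ext rfl

/-- The torus element `diag(ϖ^k, ϖ^{-k}) = diagonalUnit (fun i => ϖ ^ m i)`, `m = ![k, −k]`, on the matrices. -/
theorem coe_diagonalUnit_zpow_fin_two (ϖ : Eˣ) (k : ℤ) :
    (T5CartanUniformiser.diagonalUnit (fun i => ϖ ^ (![k, -k] i)) : Matrix (Fin 2) (Fin 2) E) =
      !![((ϖ ^ k : Eˣ) : E), 0; 0, ((ϖ ^ (-k) : Eˣ) : E)] := by
  rw [T5CartanUniformiser.coe_diagonalUnit]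
  ext i j
  fin_cases i <;> fin_cases j <;> simp

/-- The Weyl element `J = P_rev` on the matrices. -/
theorem coe_permUnit_rev :
    ((T5CartanDominant.permUnit E (Fin.revPerm : Equiv.Perm (Fin 2)) : GL (Fin 2) E) :
      Matrix (Fin 2) (Fin 2) E) = !![0, 1; 1, 0] := by
  rw [T5CartanDominant.coe_permUnit]
  ext i j
  fin_cases i <;> fin_cases j <;> rfl

/-- Right multiplication by `J` swaps the columns. -/
theorem mul_permUnit_rev (g : GL (Fin 2) E) (a b c d : E)
    (hg : (g : Matrix (Fin 2) (Fin 2) E) = !![a, b; c, d]) :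
    ((g * T5CartanDominant.permUnit E (Fin.revPerm : Equiv.Perm (Fin 2)) : GL (Fin 2) E) :
      Matrix (Fin 2) (Fin 2) E) = !![b, a; d, c] := by
  rw [Units.val_mul, hg, coe_permUnit_rev, Matrix.mul_fin_two]
  simp

/-- Left multiplication by `J` swaps the rows. -/
theorem permUnit_rev_mul (g : GL (Fin 2) E) (a b c d : E)
    (hg : (g : Matrix (Fin 2) (Fin 2) E) = !![a, b; c, d]) :
    ((T5CartanDominant.permUnit E (Fin.revPerm : Equiv.Perm (Fin 2)) * g : GL (Fin 2) E) :
      Matrix (Fin 2) (Fin 2) E) = !![c, d; a, b] := by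
  rw [Units.val_mul, hg, coe_permUnit_rev, Matrix.mul_fin_two]
  simp

end MatricesNoStar

section Matrices

variable {E : Type*} [Field E] [StarRing E]

/-- THE DICTIONARY: p8's `formUnitaryGroup (antidiag(1,1))` is p3's `hypUnitary E`. -/
theorem formUnitaryGroup_hyperbolicGram :
    T5UnitaryGroupForm.formUnitaryGroup (hyperbolicGram E) = T5UnipotentCommutator.hypUnitary E := by
  ext g
  rw [T5UnitaryGroupForm.mem_formUnitaryGroup_iff, T5UnipotentCommutator.mem_hypUnitary_iff,
    hyperbolicGram_eq]
  rfl

/-- MEMBERSHIP IN `U(1,1)`, entrywise: `g = !![a, b; c, d]` lies in `U(antidiag(1,1))` iff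
`star c · a + star a · c = 0`, `star c · b + star a · d = 1`, `star d · a + star b · c = 1`,
`star d · b + star b · d = 0`. -/
theorem mem_iff_fin_two (g : GL (Fin 2) E) (a b c d : E)
    (hg : (g : Matrix (Fin 2) (Fin 2) E) = !![a, b; c, d]) :
    g ∈ T5UnitaryGroupForm.formUnitaryGroup (hyperbolicGram E) ↔
      star c * a + star a * c = 0 ∧ star c * b + star a * d = 1 ∧ star d * a + star b * c = 1 ∧
        star d * b + star b * d = 0 := by
  rw [T5UnitaryGroupForm.mem_formUnitaryGroup_iff, hg, hyperbolicGram_eq,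
    T5UnipotentCommutator.conjTranspose_fin_two, Matrix.mul_fin_two, Matrix.mul_fin_two, fin_two_eq_iff]
  simp only [mul_zero, zero_add, mul_one, add_zero]

/-- p3's `unipUnit x = !![1, x; 0, 1]` lies in `U(1,1)` iff `x` is purely imaginary (through the dictionary). -/
theorem unipUnit_mem_iff (x : E) :
    T5UnipotentCommutator.unipUnit x ∈ T5UnitaryGroupForm.formUnitaryGroup (hyperbolicGram E) ↔
      star x = -x := by
  rw [formUnitaryGroup_hyperbolicGram, T5UnipotentCommutator.unipUnit_mem_hypUnitary_iff]

/-- `n⁻(y) ∈ U(1,1)` for `y` purely imaginary. -/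
theorem lowerUnip_mem {y : E} (hy : star y = -y) :
    lowerUnip y ∈ T5UnitaryGroupForm.formUnitaryGroup (hyperbolicGram E) := by
  rw [mem_iff_fin_two (lowerUnip y) 1 0 y 1 rfl]
  simp [hy]

/-- p3's `diagUnit t = diag(t, star(t)⁻¹)` lies in `U(1,1)` (through the dictionary). -/
theorem diagUnit_mem (t : E) (ht : t ≠ 0) :
    T5UnipotentCommutator.diagUnit t ht ∈ T5UnitaryGroupForm.formUnitaryGroup (hyperbolicGram E) := by
  rw [formUnitaryGroup_hyperbolicGram]
  exact T5UnipotentCommutator.diagUnit_mem_hypUnitary t ht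

/-- `diagUnit t` on the matrices. -/
theorem coe_diagUnit (t : E) (ht : t ≠ 0) :
    (T5UnipotentCommutator.diagUnit t ht : Matrix (Fin 2) (Fin 2) E) = !![t, 0; 0, (star t)⁻¹] := rfl

/-- `J ∈ U(1,1)`. -/
theorem permUnit_rev_mem :
    T5CartanDominant.permUnit E (Fin.revPerm : Equiv.Perm (Fin 2)) ∈
      T5UnitaryGroupForm.formUnitaryGroup (hyperbolicGram E) := by
  rw [mem_iff_fin_two _ 0 1 1 0 coe_permUnit_rev]
  simp

/-- `star a ≠ 0` for `a ≠ 0`. -/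
theorem star_ne_zero' {a : E} (ha : a ≠ 0) : star a ≠ 0 := by
  intro h
  apply ha
  simpa using congrArg star h

/-- From the first isotropy relation, `−c/a` is purely imaginary. -/
theorem star_neg_div_of_rel {a c : E} (ha : a ≠ 0) (h1 : star c * a + star a * c = 0) :
    star (-(c / a)) = -(-(c / a)) := by
  rw [star_neg, star_div₀, neg_neg]
  have hsa := star_ne_zero' ha
  have key : star c / star a = -(c / a) := by
    rw [div_eq_iff hsa, neg_mul, div_mul_eq_mul_div, eq_neg_iff_add_eq_zero, add_div' _ _ _ ha,
      div_eq_zero_iff]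
    left
    linear_combination h1
  rw [key, neg_neg]

/-- THE CORE REDUCTION, first half: `n⁻(−c/a) · !![a, b; c, d] = !![a, b; 0, star(a)⁻¹]` for
`!![a, b; c, d] ∈ U(1,1)`, `a ≠ 0`. -/
theorem lowerUnip_mul {a b c d : E} (ha : a ≠ 0)
    (h1 : star c * a + star a * c = 0) (h2 : star c * b + star a * d = 1) :
    !![1, 0; -(c / a), 1] * !![a, b; c, d] = !![a, b; 0, (star a)⁻¹] := by
  rw [Matrix.mul_fin_two, fin_two_eq_iff]
  have hsa := star_ne_zero' ha
  refine ⟨by ring, by ring, by field_simp; ring, ?_⟩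
  apply eq_inv_of_mul_eq_one_right
  field_simp
  linear_combination a * h2 - b * h1

/-- THE CORE REDUCTION: `n⁻(−c/a) · g · n(−b/a) = diag(a, star(a)⁻¹)` (`n = unipUnit`, p3). -/
theorem lowerUnip_mul_mul_unipUnit {a b c d : E} (ha : a ≠ 0)
    (h1 : star c * a + star a * c = 0) (h2 : star c * b + star a * d = 1) :
    !![1, 0; -(c / a), 1] * !![a, b; c, d] * T5UnipotentCommutator.unip (-(b / a)) =
      !![a, 0; 0, (star a)⁻¹] := by
  rw [lowerUnip_mul ha h1 h2, T5UnipotentCommutator.unip, Matrix.mul_fin_two, fin_two_eq_iff]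
  refine ⟨by ring, by field_simp; ring, by ring, by ring⟩

/-- The `(2,2)` relation of the upper-triangular element `!![a, b; 0, star(a)⁻¹] ∈ U(1,1)` makes `−b/a`
purely imaginary. -/
theorem star_neg_div_of_upper {a b : E}
    (h4 : star (star a)⁻¹ * b + star b * (star a)⁻¹ = 0) : star (-(b / a)) = -(-(b / a)) := by
  rw [star_neg, star_div₀, neg_neg]
  rw [star_inv₀, star_star, inv_mul_eq_div, ← div_eq_mul_inv] at h4
  have key : star b / star a = -(b / a) := eq_neg_of_add_eq_zero_right h4
  rw [key, neg_neg]

end Matrices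

section Integral

variable {R : Type*} [CommRing R] {E : Type*} [Field E] [Algebra R E] [IsFractionRing R E]

/-- p3's `unipUnit y ∈ GL₂(R)` for `y` integral. -/
theorem unipUnit_mem_range {y : E} (hy : IsLocalization.IsInteger R y) :
    T5UnipotentCommutator.unipUnit y ∈ (Matrix.GeneralLinearGroup.map (algebraMap R E)).range := by
  obtain ⟨r, rfl⟩ := hy
  refine T5CongruenceConjugation.mem_range_of_map_eq (IsFractionRing.injective R E)
    (T5UnipotentCommutator.unipUnit _) !![1, r; 0, 1] !![1, -r; 0, 1] ?_ ?_
  · rw [map_fin_two, map_one, map_zero]; rfl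
  · rw [map_fin_two, map_one, map_zero, map_neg]; rfl

/-- `n⁻(y) ∈ GL₂(R)` for `y` integral. -/
theorem lowerUnip_mem_range {y : E} (hy : IsLocalization.IsInteger R y) :
    lowerUnip y ∈ (Matrix.GeneralLinearGroup.map (algebraMap R E)).range := by
  obtain ⟨r, rfl⟩ := hy
  refine T5CongruenceConjugation.mem_range_of_map_eq (IsFractionRing.injective R E) (lowerUnip _)
    !![1, 0; r, 1] !![1, 0; -r, 1] ?_ ?_
  · rw [map_fin_two, map_one, map_zero]; rfl
  · rw [map_fin_two, map_one, map_zero, map_neg]; rfl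

/-- p3's `diagUnit t ∈ GL₂(R)` for `t`, `t⁻¹`, `star t`, `(star t)⁻¹` integral. -/
theorem diagUnit_mem_range [StarRing E] {t : E} (ht : t ≠ 0) (h1 : IsLocalization.IsInteger R t)
    (h2 : IsLocalization.IsInteger R t⁻¹) (h3 : IsLocalization.IsInteger R (star t))
    (h4 : IsLocalization.IsInteger R (star t)⁻¹) :
    T5UnipotentCommutator.diagUnit t ht ∈ (Matrix.GeneralLinearGroup.map (algebraMap R E)).range := by
  obtain ⟨r1, hr1⟩ := h1
  obtain ⟨r2, hr2⟩ := h2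
  obtain ⟨r3, hr3⟩ := h3
  obtain ⟨r4, hr4⟩ := h4
  refine T5CongruenceConjugation.mem_range_of_map_eq (IsFractionRing.injective R E)
    (T5UnipotentCommutator.diagUnit t ht) !![r1, 0; 0, r4] !![r2, 0; 0, r3] ?_ ?_
  · rw [map_fin_two, map_zero, hr1, hr4]; rfl
  · rw [map_fin_two, map_zero, hr2, hr3]; rfl

omit [IsFractionRing R E] in
/-- `J ∈ GL₂(R)`. -/
theorem permUnit_rev_mem_range :
    T5CartanDominant.permUnit E (Fin.revPerm : Equiv.Perm (Fin 2)) ∈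
      (Matrix.GeneralLinearGroup.map (algebraMap R E)).range :=
  T5UnitaryGroupForm.permUnit_mem_range _

end Integral

end Summit.Ventures.HodgeRepro2.T5HyperbolicUnitaryElements
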